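import Summits.HodgeConjecture.HodgeConjecture.Theses.GaloisSieve

/-!
# Route GaloisSieve — `EigenlineInduction` (glue item stmt-HodgeConjecture-14569)

`BlockCancellation → FermatSurfaceEigenlines → CosetAlgebraicity → SporadicAlgebraicity →
HodgeEigenlines`: algebraicity of the Hodge eigenlines `V(α) ⊆ H²ᵖ(X²ᵖₘ)` of the Fermat varieties by
strong induction on `p` — decomposable characters by `BlockCancellation` (which consumes the statement
in all lower even dimensions), the surface case `p = 1` by `FermatSurfaceEigenlines`, and for `p ≥ 2`
the indecomposable characters on / off a Hodge line by `CosetAlgebraicity` / `SporadicAlgebraicity`.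
Pure logic over the route file; no other import, no named-fact hypothesis, no sorry.
-/

-- `Summit.HodgeConjecture.HodgeConjecture.Theorems` is the mandated namespace (single-problem
-- summit: Problem = Summit), which `linter.dupNamespace` flags on every declaration; the lakefile
-- turns the linter off tree-wide (weak option), restated here so stand-alone elaboration is
-- warning-free too.
set_option linter.dupNamespace false

namespace Summit.HodgeConjecture.HodgeConjecture.Theorems

open Literature.AlgebraicGeometry.HodgeTheory

/-- **Item stmt-HodgeConjecture-14569 (`EigenlineInduction`), route `GaloisSieve`**: strong induction
on `p`, splitting on decomposability of the character, the surface case, and the Hodge-line dichotomy.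
[cite: Shioda1979PJA, §2 Thm. 1 and §4] -/
theorem galoisSieve_eigenlineInduction_proof :
    Summit.HodgeConjecture.HodgeConjecture.Theses.GaloisSieve.EigenlineInduction := by
  intro hK hB hC hS p
  induction p using Nat.strong_induction_on with
  | _ p ih =>
  intro m _ α hp hα c hc
  by_cases hdec : FermatCharacter.IsDecomposable (Finset.univ.val.map α)
  · exact hK p m hp (fun q hq hqp β hβ c' hc' ↦ ih q hqp m β hq hβ c' hc') α hα hdec c hc
  · rcases Nat.lt_or_ge p 2 with hp2 | hp2
    · obtain rfl : p = 1 := by omega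
      exact hB m α hα c hc
    · by_cases hline : FermatCharacter.OnHodgeLine α
      · exact hC p m α hp2 hα hdec hline c hc
      · exact hS p m α hp2 hα hdec hline c hc

end Summit.HodgeConjecture.HodgeConjecture.Theorems
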